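/-
Copyright (c) 2026 the pub-hodgecm-mathlib formalisation cell (harness21).  Prover seat hodgecm-mathlib-K2Liu-p08 (g4), Track B «K2-LIT» ∕ hLiu418
#184♮, socket #42S organ S1 (ROAD W), brick F7∕F8 (T3-frame (iii-c), the κ-composition) (LEAD F0P6-plan (g14) BATCH #8 (4) «(iii) `cells_equiv` = K2Liu-p08»;
K2Liu-p01 (g8) κ-COMPOSITION SPEC 12:32:42Z (b)–(e)+(K2), taken 12:3xZ).  2026-09-04.  KERNEL: theorems only.
-/
import Summits.HodgeConjecture.HodgeConjecture.Theorems.K2LiuHermitianGramFrameChange   -- ★ p860194 (iii-c): `gram_eq_vecMulVec_of_frame`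
import Mathlib.LinearAlgebra.Matrix.NonsingularInverse
import HarnessLib

/-!
# Crux `HLiu418`, #42S-S1 ROAD W, brick (T3-frame (iii-c)): THE FRAME COORDINATE `κ : Y ≃+ (Fin 2 → R)³` AND ITS GRAM COMPATIBILITY

Cell `hodgecm-mathlib`, crux item hLiu418 = `stmt-HodgeConjecture-24832` (helper lane `--supports … --as helper`, count-neutral).  THEOREMS ONLY (no `def`, no instance,
no notation, no named-fact hypothesis, no `sorry`).  K2Liu-p01 (g8)'s κ-COMPOSITION SPEC (b)–(e)+(K2), GENERIC over a commutative ring `R` with `σ : R →+* R` (:= `LocalRing L v =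
Π_{w∣v} L_w` with `conjLocal`, EVERY place type; the place-specific READING comes afterwards: ★ inert reading p860085 ∕ ★ split reading p860045), inputs BY VALUE:
`κ₀ : Y ≃+ (ι′ → R)` (★ κ₀ p860172 `K2LiuYModelDeltaMinusCoordinate.exists_addEquiv`, `x ↦ b = halfDiff(eD⁻¹E′⁻¹(x,0))`), the tensor index `e : Fin 2 × Fin 3 ≃ ι′` (`epsV`), the Gram
`D` of the diagonal basis (`gramS (realDiagonal dV′)`), and a FRAME MATRIX `P` (rows = `u, u′, e_k` of ★ (ii-a) p860096 in the diagonal basis) with `IsUnit P.det` and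
`P·Dᵀ·σ(P)ᵀ = [[0,1,0],[1,0,0],[0,0,d]]`.  OUTPUT ★★ **`exists_frame_addEquiv`**: an additive equivalence `κ : Y ≃+ (Fin 2 → R) × (Fin 2 → R) × (Fin 2 → R)` — the composite
(b) pointwise identity ∕ (c) reindex along `e` ∕ (d) per row `a := b ᵥ* P⁻¹` ∕ (e) regroup `(a_j)_j ↦ (A, B, C)`, `A j = a_j 0`, `B j = a_j 1`, `C j = a_j 2` — with
(K1) `∀ x j, ![(κ x).1 j, (κ x).2.1 j, (κ x).2.2 j] ᵥ* P = fun l => κ₀ x (e (j, l))` (frame coordinates times the frame = diagonal coordinates) and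
(K2) **GRAM COMPATIBILITY** `∀ x j i, Σ_k Σ_l b_j(l)·D_{kl}·σ(b_i(k)) = ((κ x).1 σ((κ x).2.1)ᵀ + (κ x).2.1 σ((κ x).1)ᵀ + d·(κ x).2.2 σ((κ x).2.2)ᵀ) j i` — ★ (T3a)'s Gram of `φ x` IS
★ (T3-core)'s Gram of `κ x` (★ `gram_eq_vecMulVec_of_frame`).  Also `vecMul_nonsing_inv_vecMul` ∕ `vecMul_vecMul_nonsing_inv` (the (d)-layer inverses) and `exists_frame_addEquiv_formula`
(κ as an explicit formula, for linearity ∕ continuity (K3) at the call site).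
[Shimura1997, §13.2] [Scharlau1985HermitianForms, Ch. 7 §1].
HONEST LABEL.  Count-neutral helper; `HC_CM` is proved only modulo the 7 printed citations (2 remaining named inputs: hLiu418 = `stmt-HodgeConjecture-24832`,
h413 = `stmt-HodgeConjecture-24833`) until rung 0 closes.  NOT here: (K3) topology (every layer is `L⁺_v`-linear on a finite free module — the call site's one-liner) and the LAST FILES.

## References
* [Shimura1997] G. Shimura, *Euler products and Eisenstein series*, CBMS 93 (1997), §13.2.
* [Scharlau1985HermitianForms] W. Scharlau, *Quadratic and Hermitian Forms*, Grundlehren 270 (1985), Ch. 7 §1.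
-/

set_option autoImplicit false
set_option linter.dupNamespace false -- the mandated namespace repeats `HodgeConjecture.HodgeConjecture`

open Matrix

namespace Summit.HodgeConjecture.HodgeConjecture.Cruxes.HLiu418.K2LiuWitnessFrameCoordinate

open K2LiuHermitianGramFrameChange

variable {R : Type*} [CommRing R]

/-- `(b ᵥ* P⁻¹) ᵥ* P = b` for `IsUnit P.det`. [folklore] -/
theorem vecMul_nonsing_inv_vecMul {n : Type*} [Fintype n] [DecidableEq n] {P : Matrix n n R} (hP : IsUnit P.det) (b : n → R) : (b ᵥ* P⁻¹) ᵥ* P = b := by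
  rw [vecMul_vecMul, nonsing_inv_mul P hP, vecMul_one]

/-- `(a ᵥ* P) ᵥ* P⁻¹ = a` for `IsUnit P.det`. [folklore] -/
theorem vecMul_vecMul_nonsing_inv {n : Type*} [Fintype n] [DecidableEq n] {P : Matrix n n R} (hP : IsUnit P.det) (a : n → R) : (a ᵥ* P) ᵥ* P⁻¹ = a := by
  rw [vecMul_vecMul, mul_nonsing_inv P hP, vecMul_one]

omit [CommRing R] in
/-- `![f 0, f 1, f 2] = f`. [folklore] -/
theorem vecCons_three_eta (f : Fin 3 → R) : ![f 0, f 1, f 2] = f := by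
  funext l
  fin_cases l <;> rfl

/-- **THE FRAME COORDINATE** (K2Liu-p01 (g8)'s κ-composition (b)–(e), with (K1) and the Gram compatibility (K2)).  For `κ₀ : Y ≃+ (ι′ → R)`, `e : Fin 2 × Fin 3 ≃ ι′`,
a frame matrix `P` with `IsUnit P.det` and `P·Dᵀ·σ(P)ᵀ = [[0,1,0],[1,0,0],[0,0,d]]`: there is `κ : Y ≃+ (Fin 2 → R)³` with
(K1) `![(κ x).1 j, (κ x).2.1 j, (κ x).2.2 j] ᵥ* P = (l ↦ κ₀ x (e (j,l)))` and
(K2) `Σ_k Σ_l κ₀ x (e(j,l))·D_{kl}·σ(κ₀ x (e(i,k))) = ((κ x).1 σ((κ x).2.1)ᵀ + (κ x).2.1 σ((κ x).1)ᵀ + d·(κ x).2.2 σ((κ x).2.2)ᵀ) j i`.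
[cite: Shimura1997, §13.2] [cite: Scharlau1985HermitianForms, Ch. 7 §1] -/
theorem exists_frame_addEquiv {Y : Type*} [AddCommGroup Y] {ι' : Type*} (κ₀ : Y ≃+ (ι' → R)) (e : Fin 2 × Fin 3 ≃ ι') (σ : R →+* R)
    {D P : Matrix (Fin 3) (Fin 3) R} {d : R} (hPdet : IsUnit P.det) (hP : P * Dᵀ * (P.map σ)ᵀ = !![0, 1, 0; 1, 0, 0; 0, 0, d]) :
    ∃ κ : Y ≃+ (Fin 2 → R) × (Fin 2 → R) × (Fin 2 → R),
      (∀ x j, ![(κ x).1 j, (κ x).2.1 j, (κ x).2.2 j] ᵥ* P = fun l => κ₀ x (e (j, l))) ∧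
      ∀ x j i, (∑ k, ∑ l, κ₀ x (e (j, l)) * D k l * σ (κ₀ x (e (i, k)))) =
        (vecMulVec (κ x).1 (fun r => σ ((κ x).2.1 r)) + vecMulVec (κ x).2.1 (fun r => σ ((κ x).1 r)) + d • vecMulVec (κ x).2.2 (fun r => σ ((κ x).2.2 r))) j i := by
  classical
  -- (c) reindex along `e`: `(ι′ → R) ≃+ (Fin 2 → Fin 3 → R)`
  let κc : (ι' → R) ≃+ (Fin 2 → Fin 3 → R) :=
    { toFun := fun f j l => f (e (j, l))
      invFun := fun g i => g (e.symm i).1 (e.symm i).2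
      left_inv := fun f => funext fun i => by simp only [Prod.mk.eta, Equiv.apply_symm_apply]
      right_inv := fun g => funext fun j => funext fun l => by simp only [Equiv.symm_apply_apply]
      map_add' := fun f g => rfl }
  -- (d) per row, the frame change `b ↦ a = b ᵥ* P⁻¹`
  let κd : (Fin 2 → Fin 3 → R) ≃+ (Fin 2 → Fin 3 → R) :=
    { toFun := fun g j => g j ᵥ* P⁻¹
      invFun := fun g j => g j ᵥ* P
      left_inv := fun g => funext fun j => vecMul_nonsing_inv_vecMul hPdet (g j)
      right_inv := fun g => funext fun j => vecMul_vecMul_nonsing_inv hPdet (g j)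
      map_add' := fun f g => funext fun j => add_vecMul _ _ _ }
  -- (e) regroup `(a_j)_j ↦ (A, B, C)`
  let κe : (Fin 2 → Fin 3 → R) ≃+ (Fin 2 → R) × (Fin 2 → R) × (Fin 2 → R) :=
    { toFun := fun g => (fun j => g j 0, fun j => g j 1, fun j => g j 2)
      invFun := fun t j => ![t.1 j, t.2.1 j, t.2.2 j]
      left_inv := fun g => funext fun j => vecCons_three_eta (g j)
      right_inv := fun t => by obtain ⟨A, B, C⟩ := t; rfl
      map_add' := fun f g => rfl }
  refine ⟨κ₀.trans (κc.trans (κd.trans κe)), fun x j => ?_, fun x j i => ?_⟩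
  · -- (K1): the frame coordinates times the frame are the diagonal coordinates
    show ![((κ₀ x ∘ fun l => e (j, l)) ᵥ* P⁻¹) 0, ((κ₀ x ∘ fun l => e (j, l)) ᵥ* P⁻¹) 1, ((κ₀ x ∘ fun l => e (j, l)) ᵥ* P⁻¹) 2] ᵥ* P = _
    rw [vecCons_three_eta, vecMul_nonsing_inv_vecMul hPdet]
    rfl
  · -- (K2): Gram compatibility through ★ `gram_eq_vecMulVec_of_frame` with `a j := b j ᵥ* P⁻¹`
    have key := gram_eq_vecMulVec_of_frame σ hP (fun r => (fun l => κ₀ x (e (r, l))) ᵥ* P⁻¹) j i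
    simp only [vecMul_nonsing_inv_vecMul hPdet] at key
    rw [key]
    rfl

end Summit.HodgeConjecture.HodgeConjecture.Cruxes.HLiu418.K2LiuWitnessFrameCoordinate
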